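import Literature.MathematicalPhysics.KineticTheory.PrefixRungEnergyBlocks
import HarnessLib

/-!
# The host block of the prefix cell chain: projection, force, and the linear integral equation it solves along a driven path

Trunk T-KINETIC (Literature/MathematicalPhysics/KineticTheory). For the MIXED rung
`cellChain ω₂ lam β γ (· < k)` on `N = k + 1 + n` sites, the HOST block — the sites
`Fin.natAdd (k+1) j`, `j : Fin n`, all harmonic (pinning `ω₂ q²/2`, unit bonds), with the right
Langevin bath at the last site — is a LINEAR system driven by the position `q_k` of the last cell
site through the harmonic interface bond `k`. Along the pathwise solution
`z(t) = x + (0, η(t)) + ∫₀ᵗ Y(z)` of the Langevin equation driven by a momentum-noise path `η`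
supported on the two bath sites, the host coordinates `X = hostProj ∘ z`, restarted at any time
`s₀`, solve exactly the forced linear integral equation of
`DampedHarmonicBlockObservability.lean` / the crux stub `stub_prefixHostObservability`, with forcing
`u(t) = q_k(s₀ + t)` and noise `ξ(t) = η_{N-1}(s₀ + t) - η_{N-1}(s₀)`:

* `prefixHostProj k n` — the projection `PhaseSpace (k+1+n) →L[ℝ] PhaseSpace n` onto the host block;
* `prefixRung_hostProj_langevinDrift` — the host block of the Langevin drift of the rung is the
  linear host field with the interface position as forcing;
* `prefixRung_host_integralEq` — the restarted host integral equation.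

## References

* F. Bonetto, J. L. Lebowitz, L. Rey-Bellet, in *Mathematical Physics 2000*, §3 eq. (8), §4.1
  eq. (10) (the equations of motion).
* N. Cuneo, J.-P. Eckmann, M. Hairer, L. Rey-Bellet, EJP 23 (2018) no. 55, eq. (2.2).
-/

noncomputable section

open MeasureTheory Filter Topology Set Metric Function Finset
open scoped NNReal

namespace Literature.MathematicalPhysics.KineticTheory.HeatConduction

open OscillatorChain Literature.Analysis.ODE

/-! ### The host-block projection -/

section Proj

variable (k n : ℕ)

/-- The **projection onto the host block**: `(q, p) ↦ ((q_{k+1+j})_j, (p_{k+1+j})_j)`, a continuous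
linear map `PhaseSpace (k+1+n) → PhaseSpace n`. [folklore] -/
def prefixHostProj : PhaseSpace (k + 1 + n) →L[ℝ] PhaseSpace n :=
  (ContinuousLinearMap.pi fun j : Fin n =>
      (ContinuousLinearMap.proj (Fin.natAdd (k + 1) j)).comp
        (ContinuousLinearMap.fst ℝ (Fin (k + 1 + n) → ℝ) (Fin (k + 1 + n) → ℝ))).prod
    (ContinuousLinearMap.pi fun j : Fin n =>
      (ContinuousLinearMap.proj (Fin.natAdd (k + 1) j)).comp
        (ContinuousLinearMap.snd ℝ (Fin (k + 1 + n) → ℝ) (Fin (k + 1 + n) → ℝ)))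

/-- Position components of the host projection. [folklore] -/
@[simp] theorem prefixHostProj_fst (w : PhaseSpace (k + 1 + n)) (j : Fin n) :
    (prefixHostProj k n w).1 j = w.1 (Fin.natAdd (k + 1) j) := rfl

/-- Momentum components of the host projection. [folklore] -/
@[simp] theorem prefixHostProj_snd (w : PhaseSpace (k + 1 + n)) (j : Fin n) :
    (prefixHostProj k n w).2 j = w.2 (Fin.natAdd (k + 1) j) := rfl

end Proj

/-! ### The host block of the drift is the linear host field, forced by the interface position -/

section Drift

variable {ω₂ lam β γ : ℝ} {k n : ℕ}

/-- **The host block of the Langevin drift of the prefix rung** (`ω₂ > 0`, `lam, β, γ ≥ 0`): at the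
host site `k + 1 + j` the force is `-ω₂ q - (q - q_prev) + [j+1<n](q_next - q) - [last] γ p` with
`q_prev` the previous host site or, for `j = 0`, the last CELL site `k` (the harmonic interface
bond); all quartic terms are switched off on the host. [folklore] -/
theorem prefixRung_hostProj_langevinDrift (hω : 0 < ω₂) (hl : 0 ≤ lam) (hβ : 0 ≤ β) (hγ : 0 ≤ γ)
    (w : PhaseSpace (k + 1 + n)) :
    prefixHostProj k n ((cellChain ω₂ lam β γ (fun i => decide (i < k))).langevinDrift (k + 1 + n) w) =
      ((prefixHostProj k n w).2, fun j : Fin n =>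
        -(ω₂ * (prefixHostProj k n w).1 j) +
          (if h : j.val + 1 < n then (prefixHostProj k n w).1 ⟨j.val + 1, h⟩ - (prefixHostProj k n w).1 j
            else 0) -
          (if h : 0 < j.val then (prefixHostProj k n w).1 j - (prefixHostProj k n w).1 ⟨j.val - 1, by omega⟩
            else (prefixHostProj k n w).1 j - w.1 (Fin.castAdd n (Fin.last k))) -
          (if j.val = n - 1 then γ * (prefixHostProj k n w).2 j else 0)) := by
  set P := cellChain ω₂ lam β γ (fun i => decide (i < k)) with hP
  have hUC := cellChain_uniformlyConfining hω hl hβ hγ (fun i => decide (i < k))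
  rw [SiteChain.langevinDrift_eq _ hUC.differentiable_U hUC.differentiable_V]
  ext j
  · rfl
  · simp only [prefixHostProj_snd, prefixHostProj_fst]
    rw [SiteChain.dPotential_eq_closed, cellChain_deriv_U_eq]
    simp only [Fin.val_natAdd, decide_eq_true_eq, cellChain_deriv_V_eq, cellChain_γ]
    -- the indicators are off on the host, the bath weight is `[j = n - 1]`
    have h1 : ¬ (k + 1 + j.val < k) := by omega
    have h2 : ¬ (k + 1 + j.val - 1 < k) := by omega
    have h3 : (0 : ℕ) < k + 1 + j.val := by omega
    have hbw : bathWeight (k + 1 + n) (Fin.natAdd (k + 1) j) = if j.val = n - 1 then 1 else 0 := by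
      unfold bathWeight
      simp only [Fin.val_natAdd]
      rw [if_neg (by omega)]
      by_cases hj : j.val = n - 1
      · rw [if_pos (by omega), if_pos hj]; ring
      · rw [if_neg (by omega), if_neg hj]; ring
    rw [if_neg h1, dif_pos h3, if_neg h2, hbw]
    -- the previous site
    have hprev : w.1 (⟨k + 1 + j.val - 1, by omega⟩ : Fin (k + 1 + n)) =
        (if h : 0 < j.val then w.1 (Fin.natAdd (k + 1) ⟨j.val - 1, by omega⟩)
          else w.1 (Fin.castAdd n (Fin.last k))) := by
      split_ifs with h
      · exact congrArg w.1 (Fin.ext (by simp only [Fin.val_natAdd]; omega))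
      · exact congrArg w.1 (Fin.ext (by simp only [Fin.val_castAdd, Fin.val_last]; omega))
    rw [hprev]
    -- the next site
    by_cases hnext : j.val + 1 < n
    · have h4 : k + 1 + j.val + 1 < k + 1 + n := by omega
      have e : (⟨k + 1 + j.val + 1, h4⟩ : Fin (k + 1 + n)) = Fin.natAdd (k + 1) ⟨j.val + 1, hnext⟩ :=
        Fin.ext (by simp only [Fin.val_natAdd]; omega)
      rw [dif_pos h4, dif_pos hnext, e, if_neg h1]
      split_ifs <;> ring
    · have h4 : ¬ (k + 1 + j.val + 1 < k + 1 + n) := by omega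
      rw [dif_neg h4, dif_neg hnext]
      split_ifs <;> ring

end Drift

/-! ### The restarted host integral equation -/

section HostIE

variable {ω₂ lam β γ : ℝ} {k n : ℕ}

/-- **Along a driven path the host block solves the forced linear integral equation.** Let `z` be a
continuous solution on `[0, T]` of `z(t) = x + (0, η(t)) + ∫₀ᵗ Y(z)` for the prefix rung on
`k + 1 + n` sites (`n ≥ 1`), with a continuous momentum-noise path `η` supported on the two bath
sites `0` and `N - 1`. Then for every `s₀ ∈ [0, T]` the host coordinates `X(t) = hostProj z(s₀ + t)`
satisfy on `[0, T - s₀]` the integral equation of `stub_prefixHostObservability` with forcing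
`u(t) = q_k(s₀ + t)` (the last cell site) and noise `ξ(t) = η_{N-1}(s₀ + t) - η_{N-1}(s₀)` entering
the last momentum. [folklore] -/
theorem prefixRung_host_integralEq (hω : 0 < ω₂) (hl : 0 ≤ lam) (hβ : 0 ≤ β) (hγ : 0 ≤ γ) (hn : 0 < n)
    {x : PhaseSpace (k + 1 + n)} {η : ℝ → Fin (k + 1 + n) → ℝ} {z : ℝ → PhaseSpace (k + 1 + n)} {T : ℝ}
    (hz : IsIntegralSolutionOn ((cellChain ω₂ lam β γ (fun i => decide (i < k))).langevinDrift (k + 1 + n))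
      (fun t => x + ((0 : Fin (k + 1 + n) → ℝ), η t)) z T)
    (hzc : Continuous z)
    (hsupp : ∀ t (i : Fin (k + 1 + n)), i.val ≠ 0 → i.val + 1 ≠ k + 1 + n → η t i = 0)
    {s₀ : ℝ} (hs₀ : s₀ ∈ Icc 0 T) :
    ∀ t ∈ Icc (0 : ℝ) (T - s₀),
      prefixHostProj k n (z (s₀ + t)) = prefixHostProj k n (z (s₀ + 0)) +
        ((0 : Fin n → ℝ), fun j : Fin n => if j.val = n - 1 then
          (η (s₀ + t) (Fin.natAdd (k + 1) ⟨n - 1, by omega⟩) - η s₀ (Fin.natAdd (k + 1) ⟨n - 1, by omega⟩))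
          else 0) +
        ∫ s in (0 : ℝ)..t,
          ((prefixHostProj k n (z (s₀ + s))).2, fun j : Fin n =>
            -(ω₂ * (prefixHostProj k n (z (s₀ + s))).1 j) +
              (if h : j.val + 1 < n then (prefixHostProj k n (z (s₀ + s))).1 ⟨j.val + 1, h⟩ -
                (prefixHostProj k n (z (s₀ + s))).1 j else 0) -
              (if h : 0 < j.val then (prefixHostProj k n (z (s₀ + s))).1 j -
                (prefixHostProj k n (z (s₀ + s))).1 ⟨j.val - 1, by omega⟩
                else (prefixHostProj k n (z (s₀ + s))).1 j - (z (s₀ + s)).1 (Fin.castAdd n (Fin.last k))) -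
              (if j.val = n - 1 then γ * (prefixHostProj k n (z (s₀ + s))).2 j else 0)) := by
  set P := cellChain ω₂ lam β γ (fun i => decide (i < k)) with hP
  set Y := P.langevinDrift (k + 1 + n) with hY
  have hUC := cellChain_uniformlyConfining hω hl hβ hγ (fun i => decide (i < k))
  have hYc : Continuous Y := hUC.continuous_langevinDrift _
  set π := prefixHostProj k n with hπ
  -- the shifted integral equation
  have hshift := hz.shift (hYc.comp hzc).continuousOn hs₀
  intro t ht
  have h1 := hshift t ht
  simp only at h1
  -- apply the projection
  have h2 : π (z (s₀ + t)) = π (z s₀) + π (((0 : Fin (k + 1 + n) → ℝ), η (s₀ + t) - η s₀) : PhaseSpace (k + 1 + n)) +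
      ∫ s in (0 : ℝ)..t, π (Y (z (s₀ + s))) := by
    have hint : IntervalIntegrable (fun s => Y (z (s₀ + s))) volume 0 t :=
      ((hYc.comp hzc).comp (continuous_const.add continuous_id)).intervalIntegrable _ _
    rw [h1, map_add, map_add, π.intervalIntegral_comp_comm hint]
    congr 2
    · congr 1
      ext i <;> simp
  rw [add_zero, h2]
  congr 1
  · congr 1
    -- the noise enters the last host momentum only
    ext j
    · simp [hπ, prefixHostProj]
    · rw [hπ, prefixHostProj_snd]
      simp only [Pi.sub_apply]
      by_cases hj : j.val = n - 1
      · rw [if_pos hj]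
        have e : Fin.natAdd (k + 1) j = Fin.natAdd (k + 1) ⟨n - 1, by omega⟩ := Fin.ext (by simp [hj])
        rw [e]
      · rw [if_neg hj]
        have hs1 := hsupp (s₀ + t) (Fin.natAdd (k + 1) j) (by simp) (by simp; omega)
        have hs2 := hsupp s₀ (Fin.natAdd (k + 1) j) (by simp) (by simp; omega)
        rw [hs1, hs2, sub_zero]
  · refine intervalIntegral.integral_congr fun s _ => ?_
    rw [hY, hπ, prefixRung_hostProj_langevinDrift hω hl hβ hγ (z (s₀ + s))]

end HostIE

end Literature.MathematicalPhysics.KineticTheory.HeatConduction
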